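import Literature.AlgebraicGeometry.HodgeTheory.ArapuraFourfoldsFibredBySurfaces
import Literature.AlgebraicGeometry.HodgeTheory.ArapuraSurfaceFibredFourfolds
import HarnessLib

/-!
# Arapura 2022, Cor. 1.5 — reduction of the `GeometricallyConnected` rendering to the
# point-fibre rendering (proofs file for `ArapuraFourfoldsFibredBySurfaces`)

Topic `Literature/AlgebraicGeometry/HodgeTheory`. The tree vendors Arapura's Corollary 1.5
(*Hodge cycles and the Leray filtration*, Pacific J. Math. 319 (2022) 233–258, p. 5: "Suppose that
`dim X = 4`, and `dim Y = 2`, and the general fibre of `f : X → Y` is a surface with `p_g = 0`. Then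
the Hodge conjecture holds for `X`.", under the standing hypotheses of §1, p. 3: "`f : X → Y` is a
surjective morphism with connected fibres between smooth projective varieties") TWICE, the two
named facts differing only in the rendering of "connected fibres":

* `Arapura2022_hodgeConjecture_fourfold_fibredBySurfaces_pg_zero`
  (file `ArapuraFourfoldsFibredBySurfaces`): Mathlib's `GeometricallyConnected f.left` — every
  base change `X ×_Y Spec K`, `K` a field, is connected;
* `Arapura2022_hodgeConjecture_pgZeroSurfaceFibration` (file `ArapuraSurfaceFibredFourfolds`):
  every point-fibre `f⁻¹{y} ⊆ |X|` is preconnected.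

Mathlib proves that a geometrically connected morphism has connected point-fibres
(`AlgebraicGeometry.Scheme.Hom.isConnected_preimage_singleton`: the scheme-theoretic fibre
`f.fiber y = X ×_Y Spec κ(y)` is connected and surjects onto `f⁻¹{y}` by `Scheme.Hom.range_fiberι`),
so the second (point-fibre) fact has the WEAKER hypothesis and implies the first verbatim. This file
records that implication (`…pg_zero.of_pgZeroSurfaceFibration`), so that a single discharge of
`Arapura2022_hodgeConjecture_pgZeroSurfaceFibration` discharges both vendored copies of Cor. 1.5.

No new fact is introduced; nothing here is stronger than the source (both sides are renderings of
the same printed corollary).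

## References

* [Arapura2022] D. Arapura, *Hodge cycles and the Leray filtration*, Pacific J. Math. 319 (2022)
  233–258 = arXiv:2103.05038, §1 (p. 3, standing hypotheses), Cor. 1.5 (p. 5).
* [Stacks 0AY8 / 01JT] the underlying space of the scheme-theoretic fibre is homeomorphic to the
  point-fibre (Mathlib `Scheme.Hom.fiberHomeo`).
-/

noncomputable section

open AlgebraicGeometry

namespace Literature.AlgebraicGeometry.HodgeTheory

open Literature.AlgebraicGeometry.Motives

/-- A geometrically connected morphism of `ℂ`-schemes has (pre)connected point-fibres: the
scheme-theoretic fibre `X ×_Y Spec κ(y)` is connected (definition of `GeometricallyConnected`) and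
maps onto `f⁻¹{y}` (Mathlib `Scheme.Hom.isConnected_preimage_singleton`). This is the passage from
the "connected fibres" of Arapura's standing hypotheses (§1) in the `GeometricallyConnected`
rendering to the point-fibre rendering. [cite: Arapura2022, §1 (p. 3)] -/
theorem isPreconnected_preimage_singleton_of_geometricallyConnected {X Y : SchemeOver ℂ}
    (f : X ⟶ Y) (hconn : GeometricallyConnected f.left) (y : Y.left) :
    IsPreconnected (f.left.base ⁻¹' {y}) :=
  (f.left.isConnected_preimage_singleton y).isPreconnected

namespace Arapura2022_hodgeConjecture_fourfold_fibredBySurfaces_pg_zero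

/-- **Arapura 2022, Cor. 1.5, `GeometricallyConnected` rendering from the point-fibre rendering.**
The vendored fact `Arapura2022_hodgeConjecture_pgZeroSurfaceFibration` (hypothesis: all
point-fibres preconnected) implies `Arapura2022_hodgeConjecture_fourfold_fibredBySurfaces_pg_zero`
(hypothesis: `GeometricallyConnected f.left`), all other hypotheses and the conclusion being
syntactically identical; the only input is
`isPreconnected_preimage_singleton_of_geometricallyConnected`. [cite: Arapura2022, Cor. 1.5 (p. 5)
with §1 (p. 3)] -/
theorem of_pgZeroSurfaceFibration (h : Arapura2022_hodgeConjecture_pgZeroSurfaceFibration) :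
    Arapura2022_hodgeConjecture_fourfold_fibredBySurfaces_pg_zero :=
  fun _ _ f hX hY hf hconn hgen p c hc hpp ↦
    h f hX hY hf (isPreconnected_preimage_singleton_of_geometricallyConnected f hconn) hgen p c hc hpp

/-- Upper bound: the fact is an instance of the Hodge conjecture for smooth projective complex
varieties (its instance on the total space `X`), so nothing stronger than the summit statement is
vendored. [cite: Deligne2000, §1] -/
theorem of_hodgeConjectureFor
    (h : ∀ ⦃n : ℕ⦄ ⦃X : SchemeOver ℂ⦄, IsSmoothProjective n X → HodgeConjectureFor n X) :
    Arapura2022_hodgeConjecture_fourfold_fibredBySurfaces_pg_zero :=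
  fun _ _ _ hX _ _ _ _ p c hc hpp ↦ (h hX).2 p c hc hpp

end Arapura2022_hodgeConjecture_fourfold_fibredBySurfaces_pg_zero

end Literature.AlgebraicGeometry.HodgeTheory

end
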